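import Summits.ResolutionOfSingularities.ResolutionOfSingularities.Theorems.FrobeniusClosingPatchingRelPerfectDepthPhaseCLetterLaws
import HarnessLib

/-!
# Crux `PatchingRelPerfect` (stmt-ResolutionOfSingularities-16161), chain W5.2 — F7(β) (β-AX) PHASE C:
# the MOVE LAWS of the host/member CONTACT class (idea-1 LT-3; the strict-currency tail of C1)

[OURS · L1 W5.2 · F7(β) (β-AX) X3 `PhaseCTermination₂` · res-L1-w52-idea-1 X3 MEASURE MEMO inst. 1 §4 LT-3 «regular residual tangent
to a member» and §5.4 (C1 in STRONG currency: `W = V(y₁, x″)` repeated, FLAG F1) · res-L1-w52-plan-1 RULING G11-19 (currency STRICT,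
two-phase proof plan, tail lemma)] res-L1-w52-stub-1 g5.  Replaces the role of NO printed item; NOT a statement of the manuscript under
review (AI-written, weaker than expert review).  Ring level, ANY commutative ring, ALL exponents symbolic.

The contact-class germ (bare host `V(h)`, second host `V(a)` with `a = c·xⁱ − y` TANGENT to the member `V(y)` along `V(y, x)` when
`i ≥ 1` resp. along `V(y, c)`, `N`-summand `d·xʲ`; `x, y` members, `c, d` products of the other member letters — e.g. `c = tᵖ`, `d = t^q`):

  `K = (h) + (c xⁱ − y) + (d xʲ)`.

* `contact_exchange` — member mass `y` in the `N`-summand is traded for `c xⁱ`: `(c xⁱ − y) + (n y) = (c xⁱ − y) + (n c xⁱ)` as IDEALS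
  (the step used once in C1, `…DepthPhaseCDetachedCylinder.xChart_residual_eq`), so `N` may be taken `y`-free;
* **Π_x** (centre the curve `V(h, y, x)`; legal for `i, j ≥ 1`): `x`-chart **`(i, j) ↦ (i − 1, j − 1)`, `c, d` unchanged**
  (`contact_xChart`); `h`-chart `(h)` (`contact_hChart`); `y`-chart `K = (y) · ((h′) + (c yⁱ⁻¹x′ⁱ − 1) + (d yʲ⁻¹x′ʲ))` (`contact_yChart`) —
  by the symmetry `(x, i, j) ↔ (t, p, q)` the same three identities are the **Π_t** law for `c = x^i·…`, so ONE theorem serves both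
  descents of idea-1 §5.4;
* `contact_host_sup_member` — at `i = 0` with `c ∈ (t)` the host and the member `t` cut out `V(y, t)`: `(t c₁ − y) + (t) = (y) + (t)`;
  `contact_yChart_cofactor_eq_top` — the unit-cofactor identity behind the `⊤`-charts of C1.

Plus the 3-host notation of record `(g) + (g + φ₂) + (g + φ₃) + (n)` with `germ₄_eq` / `germ₄_factor` / `germ₄_eq_span_of_dvd` / `map_sup₄`
(W1-type germs of tri-2 v11.6, res-L1-repro-3's TailRuns).  With `…DepthPhaseCLetterLaws` (host/host class) this covers the defect types
(b)/(c) of idea-1 §1 at ring level; the END tests and the measure are the memo's.  Fact-free; design evidence only.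

## References
* The Stacks Project, Tags 0804, 0BIQ (affine blow-up algebras and their charts). [StacksProject]
* J. Kollár, *Lectures on Resolution of Singularities* (2007), (3.111) Step 3 (monomial bookkeeping). [Kollar2007]
-/

-- `Summit.<Summit>.<Sub>.Theorems` with `Sub = Summit` (single-conjunct summit, D-0017)
set_option linter.dupNamespace false

noncomputable section

open Literature.AlgebraicGeometry.Resolution

namespace Summit.ResolutionOfSingularities.ResolutionOfSingularities.Theorems

universe u

namespace DepthPhaseC

/-- The contact-class germ `K = (h) + (c xⁱ − y) + (d xʲ)`. -/
local notation3 "Kt[" h "," y "," x "," c "," d "," i "," j "]" =>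
  (Ideal.span {h} ⊔ Ideal.span {c * x ^ i - y} ⊔ Ideal.span {d * x ^ j})

section Algebra

variable {A : Type u} [CommRing A]

/-- **Member mass in the `N`-summand is traded for host letters**: `(c xⁱ − y) + (n y) = (c xⁱ − y) + (n c xⁱ)` as ideals.
[folklore] -/
theorem contact_exchange (c x y n : A) (i : ℕ) :
    Ideal.span {c * x ^ i - y} ⊔ Ideal.span {n * y} = Ideal.span {c * x ^ i - y} ⊔ Ideal.span {n * (c * x ^ i)} := by
  refine sup_span_singleton_congr ?_
  rw [show n * y - n * (c * x ^ i) = (-n) * (c * x ^ i - y) by ring]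
  exact Ideal.mul_mem_left _ _ (Ideal.mem_span_singleton_self _)

/-- The same exchange inside the germ: `(h) + (c xⁱ − y) + (n y) = (h) + (c xⁱ − y) + (n c xⁱ)`. [folklore] -/
theorem contact_germ_exchange (h c x y n : A) (i : ℕ) :
    Ideal.span {h} ⊔ Ideal.span {c * x ^ i - y} ⊔ Ideal.span {n * y} =
      Ideal.span {h} ⊔ Ideal.span {c * x ^ i - y} ⊔ Ideal.span {n * (c * x ^ i)} := by
  rw [sup_assoc, sup_assoc, contact_exchange]

/-- **Π_x, `x`-chart** (`h = x h′`, `y = x y′`; `i, j ≥ 1`): **`(i, j) ↦ (i − 1, j − 1)`**, `c, d` unchanged. [folklore] -/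
theorem contact_xChart (h' y' x c d : A) (i j : ℕ) :
    Kt[x * h', x * y', x, c, d, i + 1, j + 1] = Ideal.span {x} * Kt[h', y', x, c, d, i, j] := by
  rw [span_singleton_mul_sup₃, show c * x ^ (i + 1) - x * y' = x * (c * x ^ i - y') by ring,
    show d * x ^ (j + 1) = x * (d * x ^ j) by ring]

/-- **Π_x, `h`-chart** (`y = h y′`, `x = h x′`; `i, j ≥ 1`): the germ is `(h)`. [folklore] -/
theorem contact_hChart (y' x' h c d : A) (i j : ℕ) : Kt[h, h * y', h * x', c, d, i + 1, j + 1] = Ideal.span {h} := by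
  refine le_antisymm (sup_le (sup_le le_rfl ?_) ?_) (le_sup_of_le_left le_sup_left) <;>
    rw [Ideal.span_singleton_le_iff_mem]
  · exact Ideal.mem_span_singleton.mpr ⟨c * h ^ i * x' ^ (i + 1) - y', by ring⟩
  · exact Ideal.mem_span_singleton.mpr ⟨d * h ^ j * x' ^ (j + 1), by ring⟩

/-- **Π_x, `y`-chart** (`h = y h′`, `x = y x′`; `i, j ≥ 1`): `K = (y) · ((h′) + (c yⁱ⁻¹ x′ⁱ − 1) + (d yʲ⁻¹ x′ʲ))` — the host letter
becomes the unit-shifted non-member `c yⁱ⁻¹x′ⁱ − 1`. [folklore] -/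
theorem contact_yChart (h' x' y c d : A) (i j : ℕ) :
    Kt[y * h', y, y * x', c, d, i + 1, j + 1] =
      Ideal.span {y} * (Ideal.span {h'} ⊔ Ideal.span {c * y ^ i * x' ^ (i + 1) - 1} ⊔ Ideal.span {d * y ^ j * x' ^ (j + 1)}) := by
  rw [span_singleton_mul_sup₃, show c * (y * x') ^ (i + 1) - y = y * (c * y ^ i * x' ^ (i + 1) - 1) by ring,
    show d * (y * x') ^ (j + 1) = y * (d * y ^ j * x' ^ (j + 1)) by ring]

/-- **Unit cofactor**: `(h′) + (t e − 1) + (t² m) + (t²) = ⊤` — `t` is a unit modulo `t e − 1` (the identity behind the `⊤`-charts of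
C1's `y`-chart, for any `N`-part carrying `t²`). [folklore] -/
theorem contact_yChart_cofactor_eq_top (h' e t m : A) :
    Ideal.span {h'} ⊔ Ideal.span {t * e - 1} ⊔ Ideal.span {t ^ 2 * m} ⊔ Ideal.span {t ^ 2} = ⊤ := by
  rw [Ideal.eq_top_iff_one]
  have h1 : (t * e - 1) * (-(t * e) - 1) + t ^ 2 * e ^ 2 = 1 := by ring
  have hmem : (t * e - 1) * (-(t * e) - 1) + t ^ 2 * e ^ 2 ∈
      Ideal.span {h'} ⊔ Ideal.span {t * e - 1} ⊔ Ideal.span {t ^ 2 * m} ⊔ Ideal.span {t ^ 2} :=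
    Ideal.add_mem _
      (Ideal.mem_sup_left (Ideal.mem_sup_left (Ideal.mem_sup_right
        (Ideal.mul_mem_right _ _ (Ideal.mem_span_singleton_self _)))))
      (Ideal.mem_sup_right (Ideal.mul_mem_right _ _ (Ideal.mem_span_singleton_self _)))
  rwa [h1] at hmem

/-- **Descent to transversality**: after `i` moves Π_x the host reads `c − y′`; if `c = t·c₁` lies in the member ideal `(t)`, the
germ is `(h) + (t c₁ − y) + (d xʲ)` — recorded identity `(t c₁ − y) + (t) = (y) + (t)` (host and member `t` now cut out `V(y, t)`
transversally to `V(x)`). [folklore] -/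
theorem contact_host_sup_member (t c₁ y : A) :
    Ideal.span {t * c₁ - y} ⊔ Ideal.span {t} = Ideal.span {y} ⊔ Ideal.span {t} := by
  rw [sup_comm (Ideal.span {t * c₁ - y}), sup_comm (Ideal.span {y}), ← Ideal.span_singleton_neg y]
  refine sup_span_singleton_congr ?_
  rw [sub_neg_eq_add, sub_add_cancel]
  exact Ideal.mul_mem_right _ _ (Ideal.mem_span_singleton_self t)

/-! ### Three hosts (W1-type germs `(g) + (g + φ₂) + (g + φ₃) + (n)`): notation of record and the factor law -/

/-- **The 3-host germ as an ideal**: `(g) + (g + φ₂) + (g + φ₃) + (n) = (g) + (φ₂) + (φ₃) + (n)`. [folklore] -/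
theorem germ₄_eq (g φ₂ φ₃ n : A) :
    Ideal.span {g} ⊔ Ideal.span {g + φ₂} ⊔ Ideal.span {g + φ₃} ⊔ Ideal.span {n} =
      Ideal.span {g} ⊔ Ideal.span {φ₂} ⊔ Ideal.span {φ₃} ⊔ Ideal.span {n} := by
  rw [germ_eq g φ₂ (g + φ₃)]
  congr 1
  refine sup_span_singleton_congr ?_
  rw [add_sub_cancel_right]
  exact Ideal.mem_sup_left (Ideal.mem_span_singleton_self g)

/-- `Ideal.map` of a four-term sup of principal ideals. [folklore] -/
theorem map_sup₄ {B : Type*} [CommRing B] (f : A →+* B) (a b c d : A) :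
    (Ideal.span {a} ⊔ Ideal.span {b} ⊔ Ideal.span {c} ⊔ Ideal.span {d}).map f =
      Ideal.span {f a} ⊔ Ideal.span {f b} ⊔ Ideal.span {f c} ⊔ Ideal.span {f d} := by
  rw [Ideal.map_sup, map_sup₃, CuspMember.map_span_singleton]

/-- **Factor law for 3-host germs**: `(c g′) + (c g′ + c φ₂′) + (c g′ + c φ₃′) + (c n′) = (c) · ((g′) + (g′ + φ₂′) + (g′ + φ₃′) + (n′))`
— every chart law of a 3-host germ is this identity after the substitution. [folklore] -/
theorem germ₄_factor (c g' φ₂' φ₃' n' : A) :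
    Ideal.span {c * g'} ⊔ Ideal.span {c * g' + c * φ₂'} ⊔ Ideal.span {c * g' + c * φ₃'} ⊔ Ideal.span {c * n'} =
      Ideal.span {c} * (Ideal.span {g'} ⊔ Ideal.span {g' + φ₂'} ⊔ Ideal.span {g' + φ₃'} ⊔ Ideal.span {n'}) := by
  rw [Ideal.mul_sup, span_singleton_mul_sup₃, Ideal.span_singleton_mul_span_singleton, mul_add, mul_add]

/-- A 3-host germ on the chart of its bare host letter is that letter. [folklore] -/
theorem germ₄_eq_span_of_dvd (c φ₂' φ₃' n' : A) :
    Ideal.span {c} ⊔ Ideal.span {c + c * φ₂'} ⊔ Ideal.span {c + c * φ₃'} ⊔ Ideal.span {c * n'} = Ideal.span {c} := by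
  refine le_antisymm (sup_le (sup_le (sup_le le_rfl ?_) ?_) ?_) (le_sup_of_le_left (le_sup_of_le_left le_sup_left)) <;>
    rw [Ideal.span_singleton_le_iff_mem]
  · exact Ideal.mem_span_singleton.mpr ⟨1 + φ₂', by ring⟩
  · exact Ideal.mem_span_singleton.mpr ⟨1 + φ₃', by ring⟩
  · exact Ideal.mem_span_singleton.mpr ⟨n', by ring⟩

end Algebra

/-! ## Rees-chart packaging of Π_x -/

section Charts

variable {R : Type u} [CommRing R] (h y x c d : R)

local notation3 "c₃" => (![h, y, x] : Fin 3 → R)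

set_option maxHeartbeats 400000 in
-- instance-path defeq through `HomogeneousLocalization`'s standalone `Pow`/`Mul` (as in p508825)
/-- **Π_x, `x`-chart image**: `K · B_x = (x) · K[i − 1, j − 1](h/x, y/x)`. [cite: StacksProject, Tag 0804] -/
theorem map_contact_two (i j : ℕ) :
    (Kt[h, y, x, c, d, i + 1, j + 1]).map (chartBase c₃ 2) = Ideal.span {chartBase c₃ 2 x} *
      Kt[chartGen c₃ 2 0, chartGen c₃ 2 1, chartBase c₃ 2 x, chartBase c₃ 2 c, chartBase c₃ 2 d, i, j] := by
  have cbh : chartBase c₃ 2 h = chartBase c₃ 2 x * chartGen c₃ 2 0 := reesChartBase_apply_eq_mul_chartGen c₃ 2 0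
  have cby : chartBase c₃ 2 y = chartBase c₃ 2 x * chartGen c₃ 2 1 := reesChartBase_apply_eq_mul_chartGen c₃ 2 1
  rw [map_sup₃, map_sub, map_mul, map_mul, map_pow, map_pow, cbh, cby]
  exact contact_xChart _ _ _ _ _ i j

set_option maxHeartbeats 400000 in
-- instance-path defeq through `HomogeneousLocalization`'s standalone `Pow`/`Mul` (as in p508825)
/-- **Π_x, `h`-chart image**: `K · B_h = (h)`. [cite: StacksProject, Tag 0804] -/
theorem map_contact_zero (i j : ℕ) :
    (Kt[h, y, x, c, d, i + 1, j + 1]).map (chartBase c₃ 0) = Ideal.span {chartBase c₃ 0 h} := by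
  have cby : chartBase c₃ 0 y = chartBase c₃ 0 h * chartGen c₃ 0 1 := reesChartBase_apply_eq_mul_chartGen c₃ 0 1
  have cbx : chartBase c₃ 0 x = chartBase c₃ 0 h * chartGen c₃ 0 2 := reesChartBase_apply_eq_mul_chartGen c₃ 0 2
  rw [map_sup₃, map_sub, map_mul, map_mul, map_pow, map_pow, cby, cbx]
  exact contact_hChart _ _ _ _ _ i j

set_option maxHeartbeats 400000 in
-- instance-path defeq through `HomogeneousLocalization`'s standalone `Pow`/`Mul` (as in p508825)
/-- **Π_x, `y`-chart image**. [cite: StacksProject, Tag 0804] -/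
theorem map_contact_one (i j : ℕ) :
    (Kt[h, y, x, c, d, i + 1, j + 1]).map (chartBase c₃ 1) = Ideal.span {chartBase c₃ 1 y} *
      (Ideal.span {chartGen c₃ 1 0} ⊔ Ideal.span {chartBase c₃ 1 c * chartBase c₃ 1 y ^ i * chartGen c₃ 1 2 ^ (i + 1) - 1} ⊔
        Ideal.span {chartBase c₃ 1 d * chartBase c₃ 1 y ^ j * chartGen c₃ 1 2 ^ (j + 1)}) := by
  have cbh : chartBase c₃ 1 h = chartBase c₃ 1 y * chartGen c₃ 1 0 := reesChartBase_apply_eq_mul_chartGen c₃ 1 0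
  have cbx : chartBase c₃ 1 x = chartBase c₃ 1 y * chartGen c₃ 1 2 := reesChartBase_apply_eq_mul_chartGen c₃ 1 2
  rw [map_sup₃, map_sub, map_mul, map_mul, map_pow, map_pow, cbh, cbx]
  exact contact_yChart _ _ _ _ _ i j

end Charts

end DepthPhaseC

end Summit.ResolutionOfSingularities.ResolutionOfSingularities.Theorems

end
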